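/-
Copyright (c) 2026. All rights reserved.
Released under Apache 2.0 license as described in the file LICENSE.
-/
import Literature.NumberTheory.ComplexMultiplication.DegenerateCMTypesElementaryAbelianMajorityType
import Literature.NumberTheory.ComplexMultiplication.DegenerateCMTypesAbelianSwaps
import Literature.NumberTheory.ComplexMultiplication.DegenerateCMTypesElementaryAbelianOrderThirtyTwo
import HarnessLib

/-!
# Pair swaps of the majority type: CM types of Kubota rank `|G|/4 + 1` and `|G|/4 + 3` on every finite commutative
# group of exponent `2` of order `≥ 32`, the latter PRIMITIVE and DEGENERATE; the order-`32` rank spectrum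
# `{2, 5, 9, 11, 17}` is attained

Setting of the tree's `DegenerateCMTypesElementaryAbelianTwoGroup` (seat p10 g37-#3; T. Kubota [Kubota1965] §4
Lemma 2 = B. B. Gordon [Gordon1999HodgeAVSurvey] Prop. 9.4.1, `rank(T) = 1 + #{χ odd : Ŝ(χ) ≠ 0}`) on a finite
commutative group `G` of EXPONENT `2`, `T` a CM type w.r.t. `ρ`, `Ŝ(χ) = Σ_{t∈T} χ(t)`, sign counts
`a_χ(T) = #{t ∈ T : χ(t) = −1}` (B. Dodson's weights [Dodson1984] §3.1.1).  Ingredients, all in the tree: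
the MAJORITY TYPE `Maj = Maj(χ₁, χ₂, χ₃)` of three distinct odd characters (g39-#2
`…ElementaryAbelianMajorityType`: rank `5`, survivors `χ₁, χ₂, χ₃, χ₁χ₂χ₃` with `4Ŝ = ±|G|`, every other odd `χ`
vanishes), the PAIR SWAP `T^{t₁,t₂} = (T ∖ {t₁,t₂}) ∪ {ρt₁, ρt₂}` (g39-#1 `…AbelianSwaps`:
`Ŝ_{T^{t₁,t₂}}(χ) = Ŝ_T(χ) − 2χ(t₁)(1 + χ(t₁t₂))`), the count `4·#{χ odd : χ(g) = 1} = |G|` (g38-#4), the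
bound "a non-trivial stabiliser forces `rank ≤ |G|/4 + 1`" (g38-#8) and the order-`32` spectrum
`rank ∈ {2, 5, 9, 11, 17}` (g38-#6).  In the Boolean dictionary (C. Carlet [Carlet2020]: types on `⟨ρ⟩ × 𝔽₂ⁿ`
are Boolean functions, Kubota's survivors their Walsh supports) `Maj` is the majority function of three of the
coordinates and a pair swap changes the truth table at two points.

THIS FILE computes the rank of the pair swaps of `Maj` and settles the EXISTENCE half of the order-`32` spectrum:

* §1 `not_forall_eq_neg_one_of_mem` (for `t₁, t₂ ∈ Maj` the product `g = t₁t₂` is not in the class `(−,−,−)`),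
  **`sum_char_pair_swap_ne_zero_iff_of_majority`** (`|G| > 16`: an odd `χ` survives on `Maj^{t₁,t₂}` iff
  `χ(t₁t₂) = 1` or `χ ∈ {χ₁, χ₂, χ₃, χ₁χ₂χ₃}`), **`survivors_pair_swap_of_majority`** (the survivors are
  `{χ odd : χ(t₁t₂) = 1} ⊔ {χ ∈ {χ₁, χ₂, χ₃, χ₁χ₂χ₃} : χ(t₁t₂) = −1}`),
  `four_mul_card_survivors_pair_swap_of_majority` (`4·#surv = |G| + 4·#{χ ∈ {χ₁,χ₂,χ₃,χ₁χ₂χ₃} : χ(t₁t₂) = −1}`).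
* §2 **`typeRank_pair_swap_of_majority_of_forall_eq_one`** (`t₁t₂ ∈ N = ker χ₁ ∩ ker χ₂ ∩ ker χ₃`, `t₁ ≠ t₂`:
  rank `|G|/4 + 1`), **`typeRank_pair_swap_of_majority_of_not`** (`t₁t₂ ∉ N`: rank `|G|/4 + 3`),
  **`eq_one_of_forall_mul_mem_pair_swap_of_majority`** (the rank-`(|G|/4 + 3)` type is PRIMITIVE — trivial
  stabiliser, by the tree's `typeRank_le_of_forall_mul_mem_iff`) and `typeRank_pair_swap_lt_of_majority` (it is
  DEGENERATE).
* §3 existence: **`exists_isCMTypeWith_typeRank_eq_card_div_four_add_three`** (every finite commutative group of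
  exponent `2` and order `≥ 32` carries, w.r.t. any `ρ ≠ 1`, a PRIMITIVE DEGENERATE CM type, of rank `|G|/4 + 3`;
  contrast: in order `≤ 16` every primitive type is nondegenerate, tree `typeRank_eq_nine_of_forall_exists_mul`);
  **`exists_isCMTypeWith_typeRank_eq_iff_of_card_thirtytwo`** — ORDER `32`: A CM TYPE OF RANK `r` EXISTS IFF
  `r ∈ {2, 5, 9, 11, 17}` (the tree's `typeRank_mem_of_card_thirtytwo` is `⟹`; `⟸` by the kernel type, the
  majority type, two swaps of the kernel type, two swaps of the majority type across `N`, one swap of the kernel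
  type).  On the field side: a multiquadratic CM field of degree `32` has CM types of every rank in
  `{2, 5, 9, 11, 17}`, in particular PRIMITIVE DEGENERATE ones (rank `11`: simple `16`-dimensional abelian
  varieties with exceptional Hodge classes on some power, by Hazama) — the field dress is the sequel.

HONEST SCOPE.  Elementary character sums on Kubota's formula; the sources print the formula (Kubota, Gordon), the
weights (Dodson), the Walsh calculus and the majority function (Carlet); the swap computations and the existence
statements are this file's regrouping (for `4`-variable Boolean functions the Walsh-support sizes `1, 4, 8, 10, 16`
and their attainment are classical, e.g. by `0`, `x₁x₂x₃` (majority-like), `x₁x₂`, `x₁x₂x₃ + x₁x₄`, `x₁`-flips).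
THEOREMS ONLY: no definition, no named fact, no instance, no `sorry`.

## References

* [Kubota1965] T. Kubota, *On the field extension by complex multiplication*, Trans. AMS 118 (1965), §2, §4 Lemma 2.
* [Gordon1999HodgeAVSurvey] B. B. Gordon, *A survey of the Hodge conjecture for abelian varieties*, Prop. 9.4.1.
* [Dodson1984] B. Dodson, *The structure of Galois groups of CM-fields*, Trans. AMS 283 (1984), §3.1.1 Theorem,
  §3.2.1.
* [Carlet2020] C. Carlet, *Boolean Functions for Cryptography and Coding Theory*, CUP, §2.3 (p. 61), Ch. 9 (majority
  function, p. 335).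

## Provenance

Lane `lit-hodgefound` (Track 2, Layer A3), seat `lit-hodgefound-p10` generation 39, row g39-#3; neighbours cited
by name, nothing restated: `DegenerateCMTypesElementaryAbelianMajorityType` (`isCMTypeWith_of_majority`,
`sum_char_eq_zero_of_majority`, `survivors_eq_of_majority`, `eight_mul_card_filter_of_majority₁/₂/₃`,
`eight_mul_card_filter_add_of_majority`, `eight_mul_card_filter_eq_eq_eq_of_odd`, `exists_three_odd`,
`exists_isCMTypeWith_typeRank_eq_five`), `DegenerateCMTypesAbelianSwaps` (`AbelianSwap.isCMTypeWith_pair_swap`,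
`ExponentTwo.sum_char_pair_swap_eq_self`, `sum_char_pair_swap_ne_zero_iff_of_eq_zero`,
`sum_char_pair_swap_ne_zero_of_lt`, `isCMTypeWith_filter_eq_one`, `typeRank_insert_erase_filter_eq_one`,
`exists_isCMTypeWith_typeRank_eq_two`, `exists_isCMTypeWith_typeRank_eq_card_div_four_add_one`),
`DegenerateCMTypesElementaryAbelianWeightTwo` (`four_mul_card_odd_filter_eq`),
`DegenerateCMTypesElementaryAbelianStabilizerRank` (`typeRank_le_of_forall_mul_mem_iff`),
`DegenerateCMTypesElementaryAbelianOrderThirtyTwo` (`typeRank_mem_of_card_thirtytwo`), `HalfSystemIndexFormula`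
(`HalfSystemIndex.isCMTypeWith_swap`), `CMTypeRankCharacters` (`IsCMTypeWith.typeRank_eq_one_add_ncard_oddCharacters`).
-/

open scoped BigOperators Classical

namespace Literature.NumberTheory.ComplexMultiplication

namespace CyclicCMType

namespace ExponentTwo

variable {G : Type*} [CommGroup G] [Fintype G] [DecidableEq G] {ρ : G} {T : Finset G}
  {χ₁ χ₂ χ₃ : AddChar (Additive G) ℂ} {t₁ t₂ : G}

/-! ## §0 Helpers -/

section Helpers

omit [Fintype G] [DecidableEq G] in
/-- `g·g = 1` in exponent `2`. [folklore] -/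
private theorem mul_self_eq_one_ms (hexp : ∀ g : G, g ^ 2 = 1) (g : G) : g * g = 1 := by
  rw [← pow_two]; exact hexp g

omit [Fintype G] [DecidableEq G] in
/-- Characters of a group of exponent `2` are `±1`-valued. [cite: Kubota1965, §4 Lemma 2 (proof)] -/
private theorem char_eq_one_or_ms (hexp : ∀ g : G, g ^ 2 = 1) (χ : AddChar (Additive G) ℂ) (g : G) :
    χ (Additive.ofMul g) = 1 ∨ χ (Additive.ofMul g) = -1 :=
  character_apply_eq_one_or_of_mul_self χ (mul_self_eq_one_ms hexp g)

omit [Fintype G] [DecidableEq G] in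
/-- `χ(gh) = χ(g)χ(h)`. [folklore] -/
private theorem char_mul_ms (χ : AddChar (Additive G) ℂ) (g h : G) :
    χ (Additive.ofMul (g * h)) = χ (Additive.ofMul g) * χ (Additive.ofMul h) := by
  rw [ofMul_mul, AddChar.map_add_eq_mul]

omit [Fintype G] [DecidableEq G] in
/-- `t₁(t₁t₂) = t₂` in exponent `2`. [folklore] -/
private theorem mul_mul_self_ms (hexp : ∀ g : G, g ^ 2 = 1) (t₁ t₂ : G) : t₁ * (t₁ * t₂) = t₂ := by
  rw [← mul_assoc, mul_self_eq_one_ms hexp, one_mul]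

/-- `|G| = 2|T|`. [folklore] -/
private theorem two_mul_card_ms (h : IsCMTypeWith ρ (T : Set G)) : 2 * T.card = Fintype.card G := by
  have hρ2 : ρ * ρ = 1 := by
    have := h.invol (1 : G)
    simpa [smul_eq_mul] using this
  have hmem : ∀ x : G, ρ * x ∈ T ↔ x ∉ T := fun x => by
    have := h.rho_smul_mem_iff x
    simpa only [smul_eq_mul, Finset.mem_coe] using this
  have hinj : Function.Injective fun s : G => ρ * s := fun a b hab => mul_left_cancel hab
  have hc : Tᶜ = T.image fun s => ρ * s := by
    ext x
    rw [Finset.mem_compl, Finset.mem_image]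
    constructor
    · intro hx
      refine ⟨ρ * x, (hmem x).2 hx, ?_⟩
      show ρ * (ρ * x) = x
      rw [← mul_assoc, hρ2, one_mul]
    · rintro ⟨s, hs, rfl⟩
      exact fun hx => ((hmem s).1 hx) hs
  have h1 : Tᶜ.card = T.card := by rw [hc, Finset.card_image_of_injective _ hinj]
  have h2 := Finset.card_add_card_compl T
  omega

omit [Fintype G] [DecidableEq G] in
/-- `ρx ∈ T ⟺ x ∉ T`. [folklore] -/
private theorem rho_mul_mem_iff_ms (h : IsCMTypeWith ρ (T : Set G)) (x : G) : ρ * x ∈ T ↔ x ∉ T := by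
  have := h.rho_smul_mem_iff x
  simpa only [smul_eq_mul, Finset.mem_coe] using this

omit [Fintype G] [DecidableEq G] in
/-- The product of three odd characters is odd. [folklore] -/
private theorem add_add_apply_rho_ms (hχ₁ : χ₁ (Additive.ofMul ρ) = -1) (hχ₂ : χ₂ (Additive.ofMul ρ) = -1)
    (hχ₃ : χ₃ (Additive.ofMul ρ) = -1) : (χ₁ + χ₂ + χ₃) (Additive.ofMul ρ) = -1 := by
  simp only [AddChar.add_apply, hχ₁, hχ₂, hχ₃]
  norm_num

omit [Fintype G] [DecidableEq G] in
/-- Every member of `{χ₁, χ₂, χ₃, χ₁χ₂χ₃}` is odd. [folklore] -/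
private theorem odd_of_mem_quad (hχ₁ : χ₁ (Additive.ofMul ρ) = -1) (hχ₂ : χ₂ (Additive.ofMul ρ) = -1)
    (hχ₃ : χ₃ (Additive.ofMul ρ) = -1) {χ : AddChar (Additive G) ℂ}
    (hχ : χ ∈ ({χ₁, χ₂, χ₃, χ₁ + χ₂ + χ₃} : Finset (AddChar (Additive G) ℂ))) : χ (Additive.ofMul ρ) = -1 := by
  simp only [Finset.mem_insert, Finset.mem_singleton] at hχ
  rcases hχ with rfl | rfl | rfl | rfl
  · exact hχ₁
  · exact hχ₂
  · exact hχ₃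
  · exact add_add_apply_rho_ms hχ₁ hχ₂ hχ₃

omit [Fintype G] [DecidableEq G] in
/-- In exponent `2`, distinct characters have non-trivial product. [cite: Kubota1965, §4 Lemma 2 (proof)] -/
private theorem add_ne_zero_of_ne_ms (hexp : ∀ g : G, g ^ 2 = 1) {χ χ' : AddChar (Additive G) ℂ}
    (hne : χ ≠ χ') : χ + χ' ≠ 0 := by
  intro h0
  exact hne (add_left_cancel ((add_self_eq_zero_char hexp χ).trans h0.symm))

omit [Fintype G] [DecidableEq G] in
/-- `#{χ ∈ {χ₁, χ₂, χ₃, χ₁χ₂χ₃} : p χ}` as a sum of four indicators (the four characters are distinct).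
[folklore] -/
private theorem card_filter_quad (hexp : ∀ g : G, g ^ 2 = 1) (h12 : χ₁ ≠ χ₂) (h13 : χ₁ ≠ χ₃) (h23 : χ₂ ≠ χ₃)
    (p : AddChar (Additive G) ℂ → Prop) [DecidablePred p] :
    (({χ₁, χ₂, χ₃, χ₁ + χ₂ + χ₃} : Finset (AddChar (Additive G) ℂ)).filter p).card =
      (if p χ₁ then 1 else 0) + (if p χ₂ then 1 else 0) + (if p χ₃ then 1 else 0) +
        (if p (χ₁ + χ₂ + χ₃) then 1 else 0) := by
  have hne₁ : χ₁ ≠ χ₁ + χ₂ + χ₃ := by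
    intro h
    apply add_ne_zero_of_ne_ms hexp h23
    have : χ₁ + 0 = χ₁ + (χ₂ + χ₃) := by rw [add_zero, ← add_assoc]; exact h
    exact (add_left_cancel this).symm
  have hne₂ : χ₂ ≠ χ₁ + χ₂ + χ₃ := by
    intro h
    apply add_ne_zero_of_ne_ms hexp h13
    have : χ₂ + 0 = χ₂ + (χ₁ + χ₃) := by
      rw [add_zero]
      calc χ₂ = χ₁ + χ₂ + χ₃ := h
        _ = χ₂ + (χ₁ + χ₃) := by abel
    exact (add_left_cancel this).symm
  have hne₃ : χ₃ ≠ χ₁ + χ₂ + χ₃ := by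
    intro h
    apply add_ne_zero_of_ne_ms hexp h12
    have : χ₃ + 0 = χ₃ + (χ₁ + χ₂) := by
      rw [add_zero]
      calc χ₃ = χ₁ + χ₂ + χ₃ := h
        _ = χ₃ + (χ₁ + χ₂) := by abel
    exact (add_left_cancel this).symm
  have hn3 : χ₃ ∉ ({χ₁ + χ₂ + χ₃} : Finset (AddChar (Additive G) ℂ)) := by
    simp only [Finset.mem_singleton]; exact hne₃
  have hn2 : χ₂ ∉ ({χ₃, χ₁ + χ₂ + χ₃} : Finset (AddChar (Additive G) ℂ)) := by
    simp only [Finset.mem_insert, Finset.mem_singleton, not_or]; exact ⟨h23, hne₂⟩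
  have hn1 : χ₁ ∉ ({χ₂, χ₃, χ₁ + χ₂ + χ₃} : Finset (AddChar (Additive G) ℂ)) := by
    simp only [Finset.mem_insert, Finset.mem_singleton, not_or]; exact ⟨h12, h13, hne₁⟩
  rw [Finset.card_filter, Finset.sum_insert hn1, Finset.sum_insert hn2, Finset.sum_insert hn3,
    Finset.sum_singleton]
  ring

end Helpers

/-! ## §1 The survivors of a pair swap of the majority type -/

section Survivors

omit [Fintype G] [DecidableEq G] in
/-- **For `t₁, t₂` in the majority type, `g = t₁t₂` is not in the class `(−,−,−)`**: otherwise `t₂ = t₁g` would have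
all three signs of `t₁` reversed and could not be majority-positive. [cite: Carlet2020, Ch. 9 (majority function, p. 335)] -/
theorem not_forall_eq_neg_one_of_mem (hexp : ∀ g : G, g ^ 2 = 1)
    (hT : ∀ g : G, g ∈ T ↔ (χ₁ (Additive.ofMul g) = 1 ∧ χ₂ (Additive.ofMul g) = 1) ∨
      (χ₁ (Additive.ofMul g) = 1 ∧ χ₃ (Additive.ofMul g) = 1) ∨ (χ₂ (Additive.ofMul g) = 1 ∧ χ₃ (Additive.ofMul g) = 1))
    (h₁ : t₁ ∈ T) (h₂ : t₂ ∈ T) :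
    ¬ (χ₁ (Additive.ofMul (t₁ * t₂)) = -1 ∧ χ₂ (Additive.ofMul (t₁ * t₂)) = -1 ∧
      χ₃ (Additive.ofMul (t₁ * t₂)) = -1) := by
  rintro ⟨a1, a2, a3⟩
  have h₁' := (hT t₁).1 h₁
  have h₂' := (hT t₂).1 h₂
  rw [← mul_mul_self_ms hexp t₁ t₂] at h₂'
  simp only [char_mul_ms, a1, a2, a3] at h₂'
  revert h₁' h₂'
  rcases char_eq_one_or_ms hexp χ₁ t₁ with e1 | e1 <;> rcases char_eq_one_or_ms hexp χ₂ t₁ with e2 | e2 <;>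
    rcases char_eq_one_or_ms hexp χ₃ t₁ with e3 | e3 <;> simp only [e1, e2, e3] <;> norm_num

omit [Fintype G] [DecidableEq G] in
/-- `t₁t₂ ≠ 1` for `t₁ ≠ t₂` (exponent `2`). [folklore] -/
private theorem mul_ne_one_ms (hexp : ∀ g : G, g ^ 2 = 1) (hne : t₁ ≠ t₂) : t₁ * t₂ ≠ 1 := by
  intro h
  apply hne
  have := mul_mul_self_ms hexp t₁ t₂
  rw [h, mul_one] at this
  exact this

omit [Fintype G] [DecidableEq G] in
/-- `t₁t₂ ≠ ρ` for `t₁, t₂` in a CM type. [folklore] -/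
private theorem mul_ne_rho_ms (hexp : ∀ g : G, g ^ 2 = 1) (h : IsCMTypeWith ρ (T : Set G)) (h₁ : t₁ ∈ T)
    (h₂ : t₂ ∈ T) : t₁ * t₂ ≠ ρ := by
  intro hg
  have : ρ * t₁ = t₂ := by rw [← hg, mul_comm (t₁ * t₂) t₁, mul_mul_self_ms hexp]
  exact (rho_mul_mem_iff_ms h t₁).1 (this ▸ h₂) h₁

/-- **WHICH ODD CHARACTERS SURVIVE ON A PAIR SWAP OF THE MAJORITY TYPE** (`|G| > 16`, `t₁ ≠ t₂` in `Maj`):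
`Ŝ_{Maj^{t₁,t₂}}(χ) ≠ 0 ⟺ χ(t₁t₂) = 1 ∨ χ ∈ {χ₁, χ₂, χ₃, χ₁χ₂χ₃}` — the four survivors of `Maj` persist
(`|Ŝ| = |G|/4 > 4`), and a vanishing odd `χ` wakes up iff `χ(t₁t₂) = 1`. [cite: Kubota1965, §4 Lemma 2]
[cite: Dodson1984, §3.1.1 Theorem] -/
theorem sum_char_pair_swap_ne_zero_iff_of_majority (hexp : ∀ g : G, g ^ 2 = 1) (hρ2 : ρ * ρ = 1)
    (hχ₁ : χ₁ (Additive.ofMul ρ) = -1) (hχ₂ : χ₂ (Additive.ofMul ρ) = -1) (hχ₃ : χ₃ (Additive.ofMul ρ) = -1)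
    (h12 : χ₁ ≠ χ₂) (h13 : χ₁ ≠ χ₃) (h23 : χ₂ ≠ χ₃)
    (hT : ∀ g : G, g ∈ T ↔ (χ₁ (Additive.ofMul g) = 1 ∧ χ₂ (Additive.ofMul g) = 1) ∨
      (χ₁ (Additive.ofMul g) = 1 ∧ χ₃ (Additive.ofMul g) = 1) ∨ (χ₂ (Additive.ofMul g) = 1 ∧ χ₃ (Additive.ofMul g) = 1))
    (h16 : 16 < Fintype.card G) (h₁ : t₁ ∈ T) (h₂ : t₂ ∈ T) (hne : t₁ ≠ t₂) {χ : AddChar (Additive G) ℂ}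
    (hχ : χ (Additive.ofMul ρ) = -1) :
    ∑ s ∈ (T \ {t₁, t₂}) ∪ ({t₁, t₂} : Finset G).image (fun d => ρ * d), χ (Additive.ofMul s) ≠ 0 ↔
      χ (Additive.ofMul (t₁ * t₂)) = 1 ∨ χ ∈ ({χ₁, χ₂, χ₃, χ₁ + χ₂ + χ₃} : Finset (AddChar (Additive G) ℂ)) := by
  have h := isCMTypeWith_of_majority hexp hρ2 hχ₁ hχ₂ hχ₃ hT
  have hTc := two_mul_card_ms h
  by_cases hF : χ ∈ ({χ₁, χ₂, χ₃, χ₁ + χ₂ + χ₃} : Finset (AddChar (Additive G) ℂ))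
  · have hS : ∑ s ∈ (T \ {t₁, t₂}) ∪ ({t₁, t₂} : Finset G).image (fun d => ρ * d), χ (Additive.ofMul s) ≠ 0 := by
      refine sum_char_pair_swap_ne_zero_of_lt hexp h h₁ h₂ hne hχ ?_
      have hF' := hF
      simp only [Finset.mem_insert, Finset.mem_singleton] at hF'
      rcases hF' with rfl | rfl | rfl | rfl
      · have := eight_mul_card_filter_of_majority₁ hexp hχ₁ hχ₂ hχ₃ h12 h13 h23 hT; omega
      · have := eight_mul_card_filter_of_majority₂ hexp hχ₁ hχ₂ hχ₃ h12 h13 h23 hT; omega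
      · have := eight_mul_card_filter_of_majority₃ hexp hχ₁ hχ₂ hχ₃ h12 h13 h23 hT; omega
      · have := eight_mul_card_filter_add_of_majority hexp hρ2 hχ₁ hχ₂ hχ₃ h12 h13 h23 hT; omega
    exact ⟨fun _ => Or.inr hF, fun _ => hS⟩
  · have hF' := hF
    simp only [Finset.mem_insert, Finset.mem_singleton, not_or] at hF'
    have h0 := sum_char_eq_zero_of_majority hexp hρ2 hχ₁ hχ₂ hχ₃ h12 h13 h23 hT hχ hF'.1 hF'.2.1 hF'.2.2.1
      hF'.2.2.2
    rw [sum_char_pair_swap_ne_zero_iff_of_eq_zero hexp h h₁ h₂ hne hχ h0]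
    exact ⟨fun h1 => Or.inl h1, fun h1 => h1.resolve_right hF⟩

/-- **THE SURVIVORS OF `Maj^{t₁,t₂}`** (`|G| > 16`, `t₁ ≠ t₂` in `Maj`, `g = t₁t₂`): the odd characters with
`χ(g) = 1` (all of them survive) together with those of `χ₁, χ₂, χ₃, χ₁χ₂χ₃` with `χ(g) = −1` (untouched by the
swap). [cite: Kubota1965, §4 Lemma 2] [cite: Dodson1984, §3.1.1 Theorem] -/
theorem survivors_pair_swap_of_majority (hexp : ∀ g : G, g ^ 2 = 1) (hρ2 : ρ * ρ = 1)
    (hχ₁ : χ₁ (Additive.ofMul ρ) = -1) (hχ₂ : χ₂ (Additive.ofMul ρ) = -1) (hχ₃ : χ₃ (Additive.ofMul ρ) = -1)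
    (h12 : χ₁ ≠ χ₂) (h13 : χ₁ ≠ χ₃) (h23 : χ₂ ≠ χ₃)
    (hT : ∀ g : G, g ∈ T ↔ (χ₁ (Additive.ofMul g) = 1 ∧ χ₂ (Additive.ofMul g) = 1) ∨
      (χ₁ (Additive.ofMul g) = 1 ∧ χ₃ (Additive.ofMul g) = 1) ∨ (χ₂ (Additive.ofMul g) = 1 ∧ χ₃ (Additive.ofMul g) = 1))
    (h16 : 16 < Fintype.card G) (h₁ : t₁ ∈ T) (h₂ : t₂ ∈ T) (hne : t₁ ≠ t₂) :
    ((Finset.univ.filter fun χ : AddChar (Additive G) ℂ => χ (Additive.ofMul ρ) = -1).filter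
      fun χ => ∑ s ∈ (T \ {t₁, t₂}) ∪ ({t₁, t₂} : Finset G).image (fun d => ρ * d), χ (Additive.ofMul s) ≠ 0) =
      ((Finset.univ.filter fun χ : AddChar (Additive G) ℂ => χ (Additive.ofMul ρ) = -1).filter
        fun χ => χ (Additive.ofMul (t₁ * t₂)) = 1) ∪
      (({χ₁, χ₂, χ₃, χ₁ + χ₂ + χ₃} : Finset (AddChar (Additive G) ℂ)).filter
        fun χ => χ (Additive.ofMul (t₁ * t₂)) = -1) := by
  ext χ
  simp only [Finset.mem_union, Finset.mem_filter, Finset.mem_univ, true_and]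
  constructor
  · rintro ⟨hχ, hS⟩
    have key := (sum_char_pair_swap_ne_zero_iff_of_majority hexp hρ2 hχ₁ hχ₂ hχ₃ h12 h13 h23 hT h16 h₁ h₂ hne
      hχ).1 hS
    rcases char_eq_one_or_ms hexp χ (t₁ * t₂) with e | e
    · exact Or.inl ⟨hχ, e⟩
    · refine Or.inr ⟨key.resolve_left ?_, e⟩
      rw [e]; norm_num
  · rintro (⟨hχ, e⟩ | ⟨hF, e⟩)
    · exact ⟨hχ, (sum_char_pair_swap_ne_zero_iff_of_majority hexp hρ2 hχ₁ hχ₂ hχ₃ h12 h13 h23 hT h16 h₁ h₂ hne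
        hχ).2 (Or.inl e)⟩
    · have hχ := odd_of_mem_quad hχ₁ hχ₂ hχ₃ hF
      exact ⟨hχ, (sum_char_pair_swap_ne_zero_iff_of_majority hexp hρ2 hχ₁ hχ₂ hχ₃ h12 h13 h23 hT h16 h₁ h₂ hne
        hχ).2 (Or.inr hF)⟩

/-- **Counting the survivors of `Maj^{t₁,t₂}`**: `4·#surv = |G| + 4·#{χ ∈ {χ₁,χ₂,χ₃,χ₁χ₂χ₃} : χ(t₁t₂) = −1}`
(`4·#{χ odd : χ(g) = 1} = |G|` for `g ∉ {1, ρ}`, tree `four_mul_card_odd_filter_eq`). [cite: Kubota1965, §4 Lemma 2]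
[cite: Dodson1984, §3.1.1 Theorem] -/
theorem four_mul_card_survivors_pair_swap_of_majority (hexp : ∀ g : G, g ^ 2 = 1) (hρ2 : ρ * ρ = 1)
    (hχ₁ : χ₁ (Additive.ofMul ρ) = -1) (hχ₂ : χ₂ (Additive.ofMul ρ) = -1) (hχ₃ : χ₃ (Additive.ofMul ρ) = -1)
    (h12 : χ₁ ≠ χ₂) (h13 : χ₁ ≠ χ₃) (h23 : χ₂ ≠ χ₃)
    (hT : ∀ g : G, g ∈ T ↔ (χ₁ (Additive.ofMul g) = 1 ∧ χ₂ (Additive.ofMul g) = 1) ∨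
      (χ₁ (Additive.ofMul g) = 1 ∧ χ₃ (Additive.ofMul g) = 1) ∨ (χ₂ (Additive.ofMul g) = 1 ∧ χ₃ (Additive.ofMul g) = 1))
    (h16 : 16 < Fintype.card G) (h₁ : t₁ ∈ T) (h₂ : t₂ ∈ T) (hne : t₁ ≠ t₂) :
    4 * ((Finset.univ.filter fun χ : AddChar (Additive G) ℂ => χ (Additive.ofMul ρ) = -1).filter
      fun χ => ∑ s ∈ (T \ {t₁, t₂}) ∪ ({t₁, t₂} : Finset G).image (fun d => ρ * d),
        χ (Additive.ofMul s) ≠ 0).card =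
      Fintype.card G + 4 * ((({χ₁, χ₂, χ₃, χ₁ + χ₂ + χ₃} : Finset (AddChar (Additive G) ℂ)).filter
        fun χ => χ (Additive.ofMul (t₁ * t₂)) = -1)).card := by
  have h := isCMTypeWith_of_majority hexp hρ2 hχ₁ hχ₂ hχ₃ hT
  have hρ1 : ρ ≠ 1 := by
    intro hρ
    have := h.rho_smul_ne (1 : G)
    rw [hρ, smul_eq_mul, one_mul] at this
    exact this rfl
  rw [survivors_pair_swap_of_majority hexp hρ2 hχ₁ hχ₂ hχ₃ h12 h13 h23 hT h16 h₁ h₂ hne]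
  have hdisj : Disjoint
      (((Finset.univ.filter fun χ : AddChar (Additive G) ℂ => χ (Additive.ofMul ρ) = -1).filter
        fun χ => χ (Additive.ofMul (t₁ * t₂)) = 1))
      ((({χ₁, χ₂, χ₃, χ₁ + χ₂ + χ₃} : Finset (AddChar (Additive G) ℂ)).filter
        fun χ => χ (Additive.ofMul (t₁ * t₂)) = -1)) := by
    rw [Finset.disjoint_left]
    intro χ ha hb
    have e1 := (Finset.mem_filter.1 ha).2
    have e2 := (Finset.mem_filter.1 hb).2
    rw [e1] at e2
    norm_num at e2
  rw [Finset.card_union_of_disjoint hdisj, mul_add,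
    four_mul_card_odd_filter_eq hexp hρ1 (mul_ne_one_ms hexp hne) (mul_ne_rho_ms hexp h h₁ h₂)]

end Survivors

/-! ## §2 The ranks `|G|/4 + 1` and `|G|/4 + 3`; primitivity -/

section Ranks

/-- Kubota's count with the survivors as a finset: `rank = 1 + #surv`. [cite: Kubota1965, §4 Lemma 2] -/
private theorem typeRank_eq_one_add_card_ms {T' : Finset G} (h' : IsCMTypeWith ρ (T' : Set G)) :
    typeRank G (T' : Set G) = 1 + ((Finset.univ.filter fun χ : AddChar (Additive G) ℂ =>
      χ (Additive.ofMul ρ) = -1).filter fun χ => ∑ s ∈ T', χ (Additive.ofMul s) ≠ 0).card := by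
  rw [h'.typeRank_eq_one_add_ncard_oddCharacters, ← Set.ncard_coe_finset]
  congr 2
  ext χ
  simp only [Set.mem_setOf_eq, Finset.coe_filter, Finset.mem_filter, Finset.mem_univ, true_and]

/-- **PAIR SWAP INSIDE THE JOINT KERNEL: RANK `|G|/4 + 1`** (`|G| > 16`): if `t₁ ≠ t₂` lie in the majority type
and `g = t₁t₂ ∈ N = ker χ₁ ∩ ker χ₂ ∩ ker χ₃`, then `rank(Maj^{t₁,t₂}) = |G|/4 + 1` (the survivors are exactly the
`|G|/4` odd characters with `χ(g) = 1`; `g` still stabilises — the weight-two value).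
[cite: Kubota1965, §4 Lemma 2] [cite: Dodson1984, §3.1.1 Theorem] -/
theorem typeRank_pair_swap_of_majority_of_forall_eq_one (hexp : ∀ g : G, g ^ 2 = 1) (hρ2 : ρ * ρ = 1)
    (hχ₁ : χ₁ (Additive.ofMul ρ) = -1) (hχ₂ : χ₂ (Additive.ofMul ρ) = -1) (hχ₃ : χ₃ (Additive.ofMul ρ) = -1)
    (h12 : χ₁ ≠ χ₂) (h13 : χ₁ ≠ χ₃) (h23 : χ₂ ≠ χ₃)
    (hT : ∀ g : G, g ∈ T ↔ (χ₁ (Additive.ofMul g) = 1 ∧ χ₂ (Additive.ofMul g) = 1) ∨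
      (χ₁ (Additive.ofMul g) = 1 ∧ χ₃ (Additive.ofMul g) = 1) ∨ (χ₂ (Additive.ofMul g) = 1 ∧ χ₃ (Additive.ofMul g) = 1))
    (h16 : 16 < Fintype.card G) (h₁ : t₁ ∈ T) (h₂ : t₂ ∈ T) (hne : t₁ ≠ t₂)
    (hg₁ : χ₁ (Additive.ofMul (t₁ * t₂)) = 1) (hg₂ : χ₂ (Additive.ofMul (t₁ * t₂)) = 1)
    (hg₃ : χ₃ (Additive.ofMul (t₁ * t₂)) = 1) :
    typeRank G (((T \ {t₁, t₂}) ∪ ({t₁, t₂} : Finset G).image (fun d => ρ * d) : Finset G) : Set G) =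
      Fintype.card G / 4 + 1 := by
  have h := isCMTypeWith_of_majority hexp hρ2 hχ₁ hχ₂ hχ₃ hT
  have h' := AbelianSwap.isCMTypeWith_pair_swap h h₁ h₂
  have hcount := four_mul_card_survivors_pair_swap_of_majority hexp hρ2 hχ₁ hχ₂ hχ₃ h12 h13 h23 hT h16 h₁ h₂ hne
  have hzero : ((({χ₁, χ₂, χ₃, χ₁ + χ₂ + χ₃} : Finset (AddChar (Additive G) ℂ)).filter
      fun χ => χ (Additive.ofMul (t₁ * t₂)) = -1)).card = 0 := by
    rw [card_filter_quad hexp h12 h13 h23]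
    simp only [AddChar.add_apply, hg₁, hg₂, hg₃]
    norm_num
  rw [hzero, mul_zero, add_zero] at hcount
  rw [typeRank_eq_one_add_card_ms h']
  omega

/-- **PAIR SWAP ACROSS THE JOINT KERNEL: RANK `|G|/4 + 3`** (`|G| > 16`): if `t₁, t₂` lie in the majority type
and `g = t₁t₂ ∉ N` (not all of `χ₁(g), χ₂(g), χ₃(g)` are `+1`; they are not all `−1` either), then
`rank(Maj^{t₁,t₂}) = |G|/4 + 3` — besides the `|G|/4` odd characters with `χ(g) = 1`, exactly TWO of
`χ₁, χ₂, χ₃, χ₁χ₂χ₃` take the value `−1` at `g` and keep surviving.  In order `32` this is the rank `11`.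
[cite: Kubota1965, §4 Lemma 2] [cite: Dodson1984, §3.1.1 Theorem] -/
theorem typeRank_pair_swap_of_majority_of_not (hexp : ∀ g : G, g ^ 2 = 1) (hρ2 : ρ * ρ = 1)
    (hχ₁ : χ₁ (Additive.ofMul ρ) = -1) (hχ₂ : χ₂ (Additive.ofMul ρ) = -1) (hχ₃ : χ₃ (Additive.ofMul ρ) = -1)
    (h12 : χ₁ ≠ χ₂) (h13 : χ₁ ≠ χ₃) (h23 : χ₂ ≠ χ₃)
    (hT : ∀ g : G, g ∈ T ↔ (χ₁ (Additive.ofMul g) = 1 ∧ χ₂ (Additive.ofMul g) = 1) ∨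
      (χ₁ (Additive.ofMul g) = 1 ∧ χ₃ (Additive.ofMul g) = 1) ∨ (χ₂ (Additive.ofMul g) = 1 ∧ χ₃ (Additive.ofMul g) = 1))
    (h16 : 16 < Fintype.card G) (h₁ : t₁ ∈ T) (h₂ : t₂ ∈ T)
    (hg : ¬ (χ₁ (Additive.ofMul (t₁ * t₂)) = 1 ∧ χ₂ (Additive.ofMul (t₁ * t₂)) = 1 ∧
      χ₃ (Additive.ofMul (t₁ * t₂)) = 1)) :
    typeRank G (((T \ {t₁, t₂}) ∪ ({t₁, t₂} : Finset G).image (fun d => ρ * d) : Finset G) : Set G) =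
      Fintype.card G / 4 + 3 := by
  have hne : t₁ ≠ t₂ := by
    rintro rfl
    rw [mul_self_eq_one_ms hexp, ofMul_one, AddChar.map_zero_eq_one, AddChar.map_zero_eq_one,
      AddChar.map_zero_eq_one] at hg
    exact hg ⟨rfl, rfl, rfl⟩
  have h := isCMTypeWith_of_majority hexp hρ2 hχ₁ hχ₂ hχ₃ hT
  have h' := AbelianSwap.isCMTypeWith_pair_swap h h₁ h₂
  have hcount := four_mul_card_survivors_pair_swap_of_majority hexp hρ2 hχ₁ hχ₂ hχ₃ h12 h13 h23 hT h16 h₁ h₂ hne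
  have hnot := not_forall_eq_neg_one_of_mem hexp hT h₁ h₂
  have htwo : ((({χ₁, χ₂, χ₃, χ₁ + χ₂ + χ₃} : Finset (AddChar (Additive G) ℂ)).filter
      fun χ => χ (Additive.ofMul (t₁ * t₂)) = -1)).card = 2 := by
    rw [card_filter_quad hexp h12 h13 h23]
    simp only [AddChar.add_apply]
    revert hg hnot
    rcases char_eq_one_or_ms hexp χ₁ (t₁ * t₂) with e1 | e1 <;>
      rcases char_eq_one_or_ms hexp χ₂ (t₁ * t₂) with e2 | e2 <;>
        rcases char_eq_one_or_ms hexp χ₃ (t₁ * t₂) with e3 | e3 <;> simp only [e1, e2, e3] <;> norm_num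
  rw [htwo] at hcount
  rw [typeRank_eq_one_add_card_ms h']
  omega

/-- **THE RANK-`(|G|/4 + 3)` TYPE IS PRIMITIVE**: its stabiliser is trivial — a non-trivial stabilising element
would force `rank ≤ |G|/4 + 1` (tree `typeRank_le_of_forall_mul_mem_iff`). [cite: Kubota1965, §2]
[cite: Kubota1965, §4 Lemma 2] -/
theorem eq_one_of_forall_mul_mem_pair_swap_of_majority (hexp : ∀ g : G, g ^ 2 = 1) (hρ2 : ρ * ρ = 1)
    (hχ₁ : χ₁ (Additive.ofMul ρ) = -1) (hχ₂ : χ₂ (Additive.ofMul ρ) = -1) (hχ₃ : χ₃ (Additive.ofMul ρ) = -1)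
    (h12 : χ₁ ≠ χ₂) (h13 : χ₁ ≠ χ₃) (h23 : χ₂ ≠ χ₃)
    (hT : ∀ g : G, g ∈ T ↔ (χ₁ (Additive.ofMul g) = 1 ∧ χ₂ (Additive.ofMul g) = 1) ∨
      (χ₁ (Additive.ofMul g) = 1 ∧ χ₃ (Additive.ofMul g) = 1) ∨ (χ₂ (Additive.ofMul g) = 1 ∧ χ₃ (Additive.ofMul g) = 1))
    (h16 : 16 < Fintype.card G) (h₁ : t₁ ∈ T) (h₂ : t₂ ∈ T)
    (hg : ¬ (χ₁ (Additive.ofMul (t₁ * t₂)) = 1 ∧ χ₂ (Additive.ofMul (t₁ * t₂)) = 1 ∧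
      χ₃ (Additive.ofMul (t₁ * t₂)) = 1))
    {x : G} (hx : ∀ t : G, t * x ∈ (T \ {t₁, t₂}) ∪ ({t₁, t₂} : Finset G).image (fun d => ρ * d) ↔
      t ∈ (T \ {t₁, t₂}) ∪ ({t₁, t₂} : Finset G).image (fun d => ρ * d)) :
    x = 1 := by
  by_contra hx1
  have h := isCMTypeWith_of_majority hexp hρ2 hχ₁ hχ₂ hχ₃ hT
  have h' := AbelianSwap.isCMTypeWith_pair_swap h h₁ h₂
  have hle := typeRank_le_of_forall_mul_mem_iff hexp h' hx1 hx
  rw [typeRank_pair_swap_of_majority_of_not hexp hρ2 hχ₁ hχ₂ hχ₃ h12 h13 h23 hT h16 h₁ h₂ hg] at hle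
  omega

/-- **THE RANK-`(|G|/4 + 3)` TYPE IS DEGENERATE**: `rank(Maj^{t₁,t₂}) < |G|/2 + 1` (`|G| > 16`).
[cite: Kubota1965, §2] [cite: Kubota1965, §4 Lemma 2] -/
theorem typeRank_pair_swap_lt_of_majority (hexp : ∀ g : G, g ^ 2 = 1) (hρ2 : ρ * ρ = 1)
    (hχ₁ : χ₁ (Additive.ofMul ρ) = -1) (hχ₂ : χ₂ (Additive.ofMul ρ) = -1) (hχ₃ : χ₃ (Additive.ofMul ρ) = -1)
    (h12 : χ₁ ≠ χ₂) (h13 : χ₁ ≠ χ₃) (h23 : χ₂ ≠ χ₃)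
    (hT : ∀ g : G, g ∈ T ↔ (χ₁ (Additive.ofMul g) = 1 ∧ χ₂ (Additive.ofMul g) = 1) ∨
      (χ₁ (Additive.ofMul g) = 1 ∧ χ₃ (Additive.ofMul g) = 1) ∨ (χ₂ (Additive.ofMul g) = 1 ∧ χ₃ (Additive.ofMul g) = 1))
    (h16 : 16 < Fintype.card G) (h₁ : t₁ ∈ T) (h₂ : t₂ ∈ T)
    (hg : ¬ (χ₁ (Additive.ofMul (t₁ * t₂)) = 1 ∧ χ₂ (Additive.ofMul (t₁ * t₂)) = 1 ∧
      χ₃ (Additive.ofMul (t₁ * t₂)) = 1)) :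
    typeRank G (((T \ {t₁, t₂}) ∪ ({t₁, t₂} : Finset G).image (fun d => ρ * d) : Finset G) : Set G) <
      Fintype.card G / 2 + 1 := by
  have hm := eight_mul_card_filter_eq_eq_eq_of_odd hexp hχ₁ hχ₂ hχ₃ h12 h13 h23 (Or.inl rfl) (Or.inl rfl)
    (Or.inl rfl) (s₁ := (1 : ℂ)) (s₂ := (1 : ℂ)) (s₃ := (1 : ℂ))
  rw [typeRank_pair_swap_of_majority_of_not hexp hρ2 hχ₁ hχ₂ hχ₃ h12 h13 h23 hT h16 h₁ h₂ hg]
  omega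

end Ranks

/-! ## §3 Existence: primitive degenerate types in order `≥ 32`; the order-`32` spectrum is attained -/

section Existence

omit [DecidableEq G] in
/-- **EVERY FINITE COMMUTATIVE GROUP OF EXPONENT `2` AND ORDER `≥ 32` CARRIES A PRIMITIVE DEGENERATE CM TYPE**, w.r.t.
any `ρ ≠ 1`, of Kubota rank `|G|/4 + 3`: the pair swap of a majority type `Maj(χ₁,χ₂,χ₃)` at `t₁ ∈ (+,+,+)`,
`t₂ ∈ (+,+,−)`.  (On the field side: a multiquadratic CM field of degree `2^{n+1} ≥ 32` has a PRIMITIVE DEGENERATE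
CM type — simple degenerate abelian varieties of dimension `2ⁿ`, `n ≥ 4`; for degree `≤ 16` there is none, tree
`typeRank_eq_nine_of_forall_exists_mul`, `typeRank_eq_two_of_card_lt_eight`.) [cite: Kubota1965, §2]
[cite: Kubota1965, §4 Lemma 2] [cite: Dodson1984, §3.2.1 Theorem] -/
theorem exists_isCMTypeWith_typeRank_eq_card_div_four_add_three (hexp : ∀ g : G, g ^ 2 = 1) (hρ1 : ρ ≠ 1)
    (h32 : 32 ≤ Fintype.card G) :
    ∃ T : Finset G, IsCMTypeWith ρ (T : Set G) ∧ typeRank G (T : Set G) = Fintype.card G / 4 + 3 ∧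
      ∀ x : G, (∀ t : G, t * x ∈ T ↔ t ∈ T) → x = 1 := by
  classical
  have hρ2 : ρ * ρ = 1 := mul_self_eq_one_ms hexp ρ
  obtain ⟨χ₁, χ₂, χ₃, hχ₁, hχ₂, hχ₃, h12, h13, h23⟩ := exists_three_odd hexp hρ1 (by omega)
  set T : Finset G := Finset.univ.filter fun g : G => (χ₁ (Additive.ofMul g) = 1 ∧ χ₂ (Additive.ofMul g) = 1) ∨
      (χ₁ (Additive.ofMul g) = 1 ∧ χ₃ (Additive.ofMul g) = 1) ∨ (χ₂ (Additive.ofMul g) = 1 ∧ χ₃ (Additive.ofMul g) = 1)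
    with hTdef
  have hT : ∀ g : G, g ∈ T ↔ (χ₁ (Additive.ofMul g) = 1 ∧ χ₂ (Additive.ofMul g) = 1) ∨
      (χ₁ (Additive.ofMul g) = 1 ∧ χ₃ (Additive.ofMul g) = 1) ∨ (χ₂ (Additive.ofMul g) = 1 ∧ χ₃ (Additive.ofMul g) = 1) :=
    fun g => by rw [hTdef, Finset.mem_filter]; simp
  -- `t₁` in the class `(+,+,+)`, `t₂` in the class `(+,+,−)`: both classes have `|G|/8 ≥ 4` elements
  have c1 := eight_mul_card_filter_eq_eq_eq_of_odd hexp hχ₁ hχ₂ hχ₃ h12 h13 h23 (Or.inl rfl) (Or.inl rfl)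
    (Or.inl rfl) (s₁ := (1 : ℂ)) (s₂ := (1 : ℂ)) (s₃ := (1 : ℂ))
  have c2 := eight_mul_card_filter_eq_eq_eq_of_odd hexp hχ₁ hχ₂ hχ₃ h12 h13 h23 (Or.inl rfl) (Or.inl rfl)
    (Or.inr rfl) (s₁ := (1 : ℂ)) (s₂ := (1 : ℂ)) (s₃ := (-1 : ℂ))
  obtain ⟨t₁, ht₁⟩ := Finset.card_pos.1 (show 0 < (Finset.univ.filter fun g : G => χ₁ (Additive.ofMul g) = 1 ∧
    χ₂ (Additive.ofMul g) = 1 ∧ χ₃ (Additive.ofMul g) = 1).card by omega)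
  obtain ⟨t₂, ht₂⟩ := Finset.card_pos.1 (show 0 < (Finset.univ.filter fun g : G => χ₁ (Additive.ofMul g) = 1 ∧
    χ₂ (Additive.ofMul g) = 1 ∧ χ₃ (Additive.ofMul g) = -1).card by omega)
  rw [Finset.mem_filter] at ht₁ ht₂
  have h₁ : t₁ ∈ T := (hT t₁).2 (Or.inl ⟨ht₁.2.1, ht₁.2.2.1⟩)
  have h₂ : t₂ ∈ T := (hT t₂).2 (Or.inl ⟨ht₂.2.1, ht₂.2.2.1⟩)
  have hg : ¬ (χ₁ (Additive.ofMul (t₁ * t₂)) = 1 ∧ χ₂ (Additive.ofMul (t₁ * t₂)) = 1 ∧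
      χ₃ (Additive.ofMul (t₁ * t₂)) = 1) := by
    rintro ⟨-, -, h3⟩
    rw [char_mul_ms, ht₁.2.2.2, ht₂.2.2.2] at h3
    norm_num at h3
  have h := isCMTypeWith_of_majority hexp hρ2 hχ₁ hχ₂ hχ₃ hT
  exact ⟨_, AbelianSwap.isCMTypeWith_pair_swap h h₁ h₂,
    typeRank_pair_swap_of_majority_of_not hexp hρ2 hχ₁ hχ₂ hχ₃ h12 h13 h23 hT (by omega) h₁ h₂ hg,
    fun x hx => eq_one_of_forall_mul_mem_pair_swap_of_majority hexp hρ2 hχ₁ hχ₂ hχ₃ h12 h13 h23 hT (by omega)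
      h₁ h₂ hg hx⟩

omit [DecidableEq G] in
/-- **A PRIMITIVE DEGENERATE type exists on every finite commutative group of exponent `2` of order `≥ 32`**
(`rank < |G|/2 + 1`, trivial stabiliser). [cite: Kubota1965, §2] [cite: Kubota1965, §4 Lemma 2] -/
theorem exists_isCMTypeWith_typeRank_lt_primitive (hexp : ∀ g : G, g ^ 2 = 1) (hρ1 : ρ ≠ 1)
    (h32 : 32 ≤ Fintype.card G) :
    ∃ T : Finset G, IsCMTypeWith ρ (T : Set G) ∧ typeRank G (T : Set G) < Fintype.card G / 2 + 1 ∧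
      ∀ x : G, (∀ t : G, t * x ∈ T ↔ t ∈ T) → x = 1 := by
  obtain ⟨T, h, hr, hprim⟩ := exists_isCMTypeWith_typeRank_eq_card_div_four_add_three hexp hρ1 h32
  refine ⟨T, h, ?_, hprim⟩
  have := two_mul_card_ms h
  rw [hr]
  omega

omit [DecidableEq G] in
/-- **ORDER `32`: a PRIMITIVE type of rank `11` exists** (w.r.t. any `ρ ≠ 1`). [cite: Kubota1965, §4 Lemma 2]
[cite: Dodson1984, §3.1.1 Theorem] -/
theorem exists_isCMTypeWith_typeRank_eq_eleven_of_card_thirtytwo (hexp : ∀ g : G, g ^ 2 = 1) (hρ1 : ρ ≠ 1)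
    (h32 : Fintype.card G = 32) :
    ∃ T : Finset G, IsCMTypeWith ρ (T : Set G) ∧ typeRank G (T : Set G) = 11 ∧
      ∀ x : G, (∀ t : G, t * x ∈ T ↔ t ∈ T) → x = 1 := by
  obtain ⟨T, h, hr, hprim⟩ := exists_isCMTypeWith_typeRank_eq_card_div_four_add_three hexp hρ1 (by omega)
  exact ⟨T, h, by rw [hr, h32], hprim⟩

omit [DecidableEq G] in
/-- **ORDER `32`: a (nondegenerate) type of rank `17` exists** — one swap of the kernel type of an odd character
(tree `typeRank_insert_erase_filter_eq_one`; also the tree's `NondegenerateCMTypeExistenceAbelian`).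
[cite: Kubota1965, §4 Lemma 2] [cite: Dodson1984, §3.1.1 Theorem] -/
theorem exists_isCMTypeWith_typeRank_eq_seventeen_of_card_thirtytwo (hexp : ∀ g : G, g ^ 2 = 1) (hρ1 : ρ ≠ 1)
    (h32 : Fintype.card G = 32) :
    ∃ T : Finset G, IsCMTypeWith ρ (T : Set G) ∧ typeRank G (T : Set G) = 17 := by
  classical
  have hρ2 : ρ * ρ = 1 := mul_self_eq_one_ms hexp ρ
  obtain ⟨χ₁, -, -, hχ₁, -⟩ := exists_three_odd hexp hρ1 (by omega)
  have h1 : χ₁ (Additive.ofMul (1 : G)) = 1 := by rw [ofMul_one, AddChar.map_zero_eq_one]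
  have hmem : (1 : G) ∈ Finset.univ.filter fun g : G => χ₁ (Additive.ofMul g) = 1 :=
    Finset.mem_filter.2 ⟨Finset.mem_univ _, h1⟩
  refine ⟨_, HalfSystemIndex.isCMTypeWith_swap (isCMTypeWith_filter_eq_one hexp hρ2 hχ₁) hmem, ?_⟩
  rw [typeRank_insert_erase_filter_eq_one hexp hρ2 (by rw [h32]; norm_num) hχ₁ h1, h32]

omit [DecidableEq G] in
/-- **THE ORDER-`32` RANK SPECTRUM IS EXACTLY `{2, 5, 9, 11, 17}`**: on a finite commutative group of exponent `2` and
order `32`, for every `ρ ≠ 1`, a CM type (w.r.t. `ρ`) of Kubota rank `r` EXISTS if and only if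
`r ∈ {2, 5, 9, 11, 17}` — `⟹` is the tree's `typeRank_mem_of_card_thirtytwo` (Parseval, parity, Titsworth, balance);
`⟸`: the kernel type of an odd character (`2`), the majority type (`5`), two swaps of the kernel type (`9`), a pair
swap of the majority type across its joint kernel (`11`), one swap of the kernel type (`17`).  Boolean form: the
Walsh support of a `4`-variable Boolean function has `1, 4, 8, 10` or `16` elements and each size occurs.  Field
side: the CM types of a multiquadratic CM field of degree `32` realise exactly the ranks `2, 5, 9, 11, 17`.
[cite: Kubota1965, §4 Lemma 2] [cite: Dodson1984, §3.1.1 Theorem] [cite: Carlet2020, §2.3 (p. 61)] -/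
theorem exists_isCMTypeWith_typeRank_eq_iff_of_card_thirtytwo (hexp : ∀ g : G, g ^ 2 = 1) (hρ1 : ρ ≠ 1)
    (h32 : Fintype.card G = 32) (r : ℕ) :
    (∃ T : Finset G, IsCMTypeWith ρ (T : Set G) ∧ typeRank G (T : Set G) = r) ↔
      r = 2 ∨ r = 5 ∨ r = 9 ∨ r = 11 ∨ r = 17 := by
  constructor
  · rintro ⟨T, h, hr⟩
    have := typeRank_mem_of_card_thirtytwo hexp h h32
    omega
  · rintro (rfl | rfl | rfl | rfl | rfl)
    · exact exists_isCMTypeWith_typeRank_eq_two hexp hρ1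
    · exact exists_isCMTypeWith_typeRank_eq_five hexp hρ1 (by omega)
    · obtain ⟨T, h, hr⟩ := exists_isCMTypeWith_typeRank_eq_card_div_four_add_one hexp hρ1 (by omega)
      exact ⟨T, h, by rw [hr, h32]⟩
    · obtain ⟨T, h, hr, -⟩ := exists_isCMTypeWith_typeRank_eq_eleven_of_card_thirtytwo hexp hρ1 h32
      exact ⟨T, h, hr⟩
    · exact exists_isCMTypeWith_typeRank_eq_seventeen_of_card_thirtytwo hexp hρ1 h32

omit [DecidableEq G] in
/-- **The set of Kubota ranks in order `32`** as a set equality: `{rank(T) : T a CM type w.r.t. ρ} = {2, 5, 9, 11, 17}`.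
[cite: Kubota1965, §4 Lemma 2] [cite: Dodson1984, §3.1.1 Theorem] -/
theorem setOf_typeRank_eq_of_card_thirtytwo (hexp : ∀ g : G, g ^ 2 = 1) (hρ1 : ρ ≠ 1)
    (h32 : Fintype.card G = 32) :
    {r : ℕ | ∃ T : Finset G, IsCMTypeWith ρ (T : Set G) ∧ typeRank G (T : Set G) = r} =
      ({2, 5, 9, 11, 17} : Set ℕ) := by
  ext r
  rw [Set.mem_setOf_eq, exists_isCMTypeWith_typeRank_eq_iff_of_card_thirtytwo hexp hρ1 h32 r]
  simp only [Set.mem_insert_iff, Set.mem_singleton_iff]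

end Existence

end ExponentTwo

end CyclicCMType

end Literature.NumberTheory.ComplexMultiplication
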